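import Summits.BirchSwinnertonDyer.BirchSwinnertonDyer.Theorems.KimAtThreeDeepLeafOfDefinedKatoUniform
import HarnessLib

/-!
# Route `KimAtThreeKolyvagin` (rung W2): the uniform fine Kato package (C1ᵤ) — the planner's ONE residual object of record
# for the W2 deep leaf — DERIVED from the defined-Kato package (C1ₑₓ) plus the rationality of Kato's constant, on
# EVERY tower row (cell `bsd-addord`, seat w2-c3 gen 7; `--supports stmt-BirchSwinnertonDyer-19076`, helper)

HONEST FRAMING: glue theorems with DISPLAYED hypotheses (no definition, no named fact, no `sorry`); nothing is closed and
nothing is booked; BSD is not proved by any of this.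

## What, and why
The planner's FOLD (STATUS 2026-08-27T03:45:57Z, (γ′)) registers the uniform fine Kato package (C1ᵤ) (this seat's gen 6,
`KimAtThreeDeepUpperUniformOfFineKato`) as the ONE open decl below the five deep decls (19075 / 19679 / 19076 / 19562 /
`N11.KimAtThreeDeepPUB`; glues w2-c2 g7 `KimAtThreeDeepLowerUniformOfFineKato`, w2-c3 g7 `KimAtThreeDeepUpperUniformPinned`).
This seat's gen-7 files `…OfDefinedKatoUniform` / `…DeepLeafOfDefinedKatoUniform` derive all five decls from the SMALLER
package (C1ₑₓ) directly, using `[0]⁺_f ≠ 0` on each crux row to show Kato's constant RATIONAL.  To serve the registered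
object (C1ᵤ) itself (a statement over EVERY tower curve, analytic rank `≥ 1` included, where `[0]⁺ = 0`), this file adds
back ONLY the rationality of Kato's constant — R-κ WITHOUT any valuation condition (n1011 rider R-κ (b): in the
`exp*_ω`-coordinate `κ = ±c_P^{-1}·(−Ω⁺Ω⁻/4π²(f,f)) ∈ ℚ`, Manin constant + the Petersson-norm / modular-degree formula) —
and proves **(C1ₑₓ⁺) ⟹ (C1ᵤ)** on every row: `κe := v₃(κ) + a`, `t := 0`, `e := a + λ₀`, `Λ ↦ 3^a·Λ`, `κ ↦ 3^a·κ`,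
`x ↦ 3^a·x` (w2-c4's `zetaBody_smul` on EVERY admissible datum), `Λfin` and the (Λ)-clauses from
`KimAtThreeDeepUpperLocalLatticeUniform.exists_finLevelFunctional_clauses_of_dual`, RIDER₂ from
`KimAtThreeDeepUpperRiderOfCompat.rider₂_of_compat`, with `a ≥ b, 1 − v₃(κ), −λ₀`.
* `fineKatoUniform_of_definedKatoUniformRat` — **(C1ₑₓ⁺) ⟹ (C1ᵤ)** (conclusion = gen 6's displayed binder `hC1` VERBATIM).
* `kimAtThreeDeepPUB_of_leaves_of_definedKatoUniformRat` — the one-line composition with w2-c2 g7's ★★ (the shape the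
  planner's (γ′) glue takes if (C1ₑₓ⁺) is registered instead of (C1ᵤ)).
HONEST LIMITS: (C1ₑₓ⁺) displays one clause more than (C1ₑₓ) (`κK ∈ ℚ`); on the crux rows (`ord(δ̃) = 0`) that clause is
itself DERIVED (`KimAtThreeDeepUpperOfDefinedKatoUniform.exists_ratCast_eq_kappa_of_zetaBody`), so the five decls need
(C1ₑₓ) only; (C1ᵤ) as a universal statement needs (C1ₑₓ⁺) (or a Rohrlich non-vanishing twist argument, not done).
References: [Kato2004Asterisque] (8.1.3), 8.12, 8.5, §9.4, 9.7, 6.6 (1), 13.3; [BlochKato1990] §3; [Kim2022StructureSelmer] §3.2–3.4,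
Thm. 3.13; [MazurRubin2004] App. A Prop. A.2; [GreenbergVatsal2000] §3 (Manin constants); [AgasheRibetStein2006] §2;
memo HOME/w2c3/W2C3-DEFINED-KATO-UNIFORM-g7.md. -/

set_option autoImplicit false
-- the Theorems namespace of a single-conjunct summit repeats the summit name by design (D-0017)
set_option linter.dupNamespace false

noncomputable section

open scoped NumberField TensorProduct ContRepresentation Classical
open CategoryTheory Field Function Finset IsDedekindDomain NumberField WeierstrassCurve
open Rat.HeightOneSpectrum
open Literature.NumberTheory.GaloisRepresentations Literature.NumberTheory.GaloisCohomology
open Literature.NumberTheory.GaloisRepresentations.DiscreteGaloisModule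
open Literature.NumberTheory.EllipticCurves Literature.NumberTheory.EllipticCurves.ModularForms
open Literature.NumberTheory.EllipticCurves.Rank1Residual
open Literature.NumberTheory.EllipticCurves.Kato2004
open Literature.NumberTheory.EllipticCurves.Kato2004.EulerSystemValues
open Summit.BirchSwinnertonDyer.Rank1Residual.GaloisImage
open Summit.BirchSwinnertonDyer.Rank1Residual.Additive
open Summit.BirchSwinnertonDyer.Rank1Residual.Additive.LocalLog
open Summit.BirchSwinnertonDyer.BirchSwinnertonDyer.Theses.KimAtThreeKolyvagin
open Summit.BirchSwinnertonDyer.BirchSwinnertonDyer.Theorems.KimAtThreeDeepUpperLocalLatticeUniform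
open Summit.BirchSwinnertonDyer.BirchSwinnertonDyer.Theorems.KimAtThreeDeepUpperRiderOfCompat
open Summit.BirchSwinnertonDyer.BirchSwinnertonDyer.Theorems.KimAtThreeShallowEqDeepZetaBodyScaling
open Summit.BirchSwinnertonDyer.BirchSwinnertonDyer.Theorems.KimAtThreeDeepLowerUniformOfFineKato
open Summit.BirchSwinnertonDyer.BirchSwinnertonDyer.Theorems

namespace Summit.BirchSwinnertonDyer.BirchSwinnertonDyer.Theorems.KimAtThreeDeepUpperFineKatoUniformOfDefinedKato

/-- Local notation: the TWO-EXPONENT rider clause (ii₂) at depth `j`, torsion exponent `t`, defect exponent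
`e`, place `v`, for the pair `(Λ, Λf)` — seat acc6's spelling, copied VERBATIM from gen 6's
`KimAtThreeDeepUpperUniformOfFineKato` (so that the conclusion below is gen 6's binder `hC1` to the letter). -/
local notation3 (prettyPrint := false) "RIDER₂⟦" W' ", " j ", " t' ", " e' ", " v' ", " Λ' ", " Λf "⟧" =>
  ∀ (r : Finset (HeightOneSpectrum (𝓞 ℚ)))
    (Ψ : H1 (tateRep W' 3) (cycSubgroup 3 0 r) →+
      continuousCohomology 1
        (subgroupRep (WeierstrassCurve.torsionGaloisModule W' (((3 : ℕ) : ℤ) ^ j * ((3 : ℕ) : ℤ))).toTopRep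
          (cycSubgroup 3 0 r))),
    (∀ (φ : contOneCocycles (subgroupRep (tateRep W' 3).toTopRep (cycSubgroup 3 0 r)))
        (ψ : contOneCocycles
          (subgroupRep (WeierstrassCurve.torsionGaloisModule W' (((3 : ℕ) : ℤ) ^ j * ((3 : ℕ) : ℤ))).toTopRep
            (cycSubgroup 3 0 r))),
        (∀ g, ((ψ.1 g : geomTorsion W' (((3 : ℕ) : ℤ) ^ j * ((3 : ℕ) : ℤ))) : geomPoints W') =
          TateModule.proj 3 (j + 1) (φ.1 g)) →
        Ψ (oneCocycleClass _ φ) = oneCocycleClass _ ψ) →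
    ∀ (y : H1 (tateRep W' 3) (cycSubgroup 3 0 r))
      (κ₀ : galoisCohomology (WeierstrassCurve.torsionGaloisModule W' (((3 : ℕ) : ℤ) ^ j * ((3 : ℕ) : ℤ))) 1)
      (s : ℤ_[3]),
      resSubgroup (WeierstrassCurve.torsionGaloisModule W' (((3 : ℕ) : ℤ) ^ j * ((3 : ℕ) : ℤ))).toTopRep
          (cycSubgroup 3 0 r) 1 κ₀ = Ψ y →
      galoisCohomology.localization (WeierstrassCurve.torsionGaloisModule W' (((3 : ℕ) : ℤ) ^ j * ((3 : ℕ) : ℤ)))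
          (Sum.inr v') 1 κ₀ ∈ propagatedSelmerStructure W' 3 j (Sum.inr v') →
      (∃ l ∈ cycIntLattice 3 (cycLevel 3 0 r),
          (((3 : ℕ) : ℤ_[3]) ^ t') • Λ' 0 r y - ((s : ℚ_[3]) ⊗ₜ[ℚ] (1 : CyclotomicField (cycLevel 3 0 r) ℚ)) =
            (((3 : ℕ) : ℤ_[3]) ^ (j + 1)) • (l : ℚ_[3] ⊗[ℚ] CyclotomicField (cycLevel 3 0 r) ℚ)) →
      ((3 ^ e' : ℕ) : ZMod (3 ^ (j + 1))) *
        Λf (galoisCohomology.localization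
          (WeierstrassCurve.torsionGaloisModule W' (((3 : ℕ) : ℤ) ^ j * ((3 : ℕ) : ℤ))) (Sum.inr v') 1 κ₀) =
        PadicInt.toZModPow (j + 1) s

section Rat

variable
  -- (C1ₑₓ⁺) = (C1ₑₓ) + R-κ (rationality of Kato's constant, NO valuation condition): per row `(ι, κK, Λ, φ)` with
  -- `κK ∈ ℚ`, `hker`, `hdual` (kim3's texts verbatim), the crude compatibility (X1-int_b), and Kato's `ZetaBody` family
  (hKUrat : ∀ (W : WeierstrassCurve ℚ) [W.IsElliptic] [W.IsGloballyMinimal]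
    [ContinuousSMul ℤ_[3] (W.tateModule 3)] [Module.Free ℤ_[3] (W.tateModule 3)]
    [Module.Finite ℤ_[3] (W.tateModule 3)],
    (∀ m : ℕ, W.HasSurjectiveModNGaloisRep (3 ^ m : ℕ)) →
    ∀ (v₃ : HeightOneSpectrum (𝓞 ℚ)), ((3 : ℕ) : 𝓞 ℚ) ∈ v₃.asIdeal →
    ∀ {N : ℕ} [NeZero N] (P : ModularParametrizationData W N), N = W.conductorNorm ℤ →
      (∀ z ∈ P.L.lattice, ∃ w ∈ periodLattice P.f, z = P.c * w) →
      ∃ (ι : (n : ℕ) → (CyclotomicField n ℚ →+* ℂ)) (κK : ℝ)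
        (Λ : ∀ (k' : ℕ) (r : Finset (HeightOneSpectrum (𝓞 ℚ))),
          H1 (tateRep W 3) (cycSubgroup 3 k' r) →ₗ[ℤ_[3]] ℚ_[3] ⊗[ℚ] CyclotomicField (cycLevel 3 k' r) ℚ)
        (φ : (tateLocalRep W 3 (Sum.inr v₃)).cohomology 1 →+ ℚ_[3]),
        κK ≠ 0 ∧ (∃ u : ℚ, (u : ℝ) = κK) ∧
        -- hker: [BK90] Prop. 3.8 / Ex. 3.11 in lattice form (kernel of `exp*_ω` = `H¹_f = E(ℚ₃) ⊗ ℤ₃`)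
        (∀ y, φ y = 0 ↔ ∀ j : ℕ, tateLocalMap W 3 j (Sum.inr v₃) y ∈
          W.kummerSelmerStructure (((3 : ℕ) : ℤ) ^ j * ((3 : ℕ) : ℤ)) (Sum.inr v₃)) ∧
        -- hdual: Tate local duality + [BK90] 3.8 in lattice form (`exp*_ω(H¹) = (log_ω E(ℚ₃))^∨`)
        (∀ a : ℚ_[3], (∃ y, φ y = a) ↔
          ∀ Q : (W.baseChange ℚ_[3]).toAffine.Point, ‖a * padicLog (W.baseChange ℚ_[3]) Q‖ ≤ 1) ∧
        -- (X1-int_b): `Λ_{0,r}` agrees with `φ` modulo `3^{j+1-b}·L_int` on restriction-compatible classes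
        (∃ b : ℕ, ∀ (j : ℕ) (r : Finset (HeightOneSpectrum (𝓞 ℚ)))
          (Ψ : H1 (tateRep W 3) (cycSubgroup 3 0 r) →+
            continuousCohomology 1 (subgroupRep
              (W.torsionGaloisModule (((3 : ℕ) : ℤ) ^ j * ((3 : ℕ) : ℤ))).toTopRep (cycSubgroup 3 0 r))),
          (∀ (φ₁ : contOneCocycles (subgroupRep (tateRep W 3).toTopRep (cycSubgroup 3 0 r)))
              (ψ : contOneCocycles (subgroupRep
                (W.torsionGaloisModule (((3 : ℕ) : ℤ) ^ j * ((3 : ℕ) : ℤ))).toTopRep (cycSubgroup 3 0 r))),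
              (∀ g, ((ψ.1 g : geomTorsion W (((3 : ℕ) : ℤ) ^ j * ((3 : ℕ) : ℤ))) : geomPoints W) =
                TateModule.proj 3 (j + 1) (φ₁.1 g)) →
              Ψ (oneCocycleClass _ φ₁) = oneCocycleClass _ ψ) →
          ∀ (y : H1 (tateRep W 3) (cycSubgroup 3 0 r))
            (κ₀ : galoisCohomology (W.torsionGaloisModule (((3 : ℕ) : ℤ) ^ j * ((3 : ℕ) : ℤ))) 1)
            (h : (tateLocalRep W 3 (Sum.inr v₃)).cohomology 1),
            resSubgroup (W.torsionGaloisModule (((3 : ℕ) : ℤ) ^ j * ((3 : ℕ) : ℤ))).toTopRep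
                (cycSubgroup 3 0 r) 1 κ₀ = Ψ y →
            galoisCohomology.localization (W.torsionGaloisModule (((3 : ℕ) : ℤ) ^ j * ((3 : ℕ) : ℤ)))
                (Sum.inr v₃) 1 κ₀ = tateLocalMap W 3 j (Sum.inr v₃) h →
            ∃ l ∈ cycIntLattice 3 (cycLevel 3 0 r),
              (((3 : ℕ) : ℤ_[3]) ^ b) • ((φ h ⊗ₜ[ℚ] (1 : CyclotomicField (cycLevel 3 0 r) ℚ)) - Λ 0 r y) =
                (((3 : ℕ) : ℤ_[3]) ^ (j + 1)) • (l : _)) ∧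
        -- Kato's Euler system with its values in the coordinate `Λ`
        ∀ (c d a : ℤ) (A : ℕ), 0 < A → Int.gcd c (6 * 3 * A) = 1 → Int.gcd d (6 * 3 * N) = 1 →
          ∃ (z : ∀ (k' : ℕ) (r : (cyclotomicLevelsRat 3 (badPlaces c d A N)).Ideals),
                H1 (tateRep W 3) ((cyclotomicLevelsRat 3 (badPlaces c d A N)).level k' r.1))
            (x : ∀ (k' : ℕ) (r : (cyclotomicLevelsRat 3 (badPlaces c d A N)).Ideals),
                CyclotomicField (cycLevel 3 k' r.1) ℚ),
            ZetaBody W 3 P.f ι κK Λ c d a A z x)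

include hKUrat

set_option backward.isDefEq.respectTransparency false in
/-- **(C1ₑₓ⁺) ⟹ (C1ᵤ): the uniform fine Kato package of record from the defined-Kato package plus the rationality of
Kato's constant, on EVERY tower row** (conclusion = gen 6's `hC1` VERBATIM).  Per row: (C1ₑₓ⁺)'s `(ι, κK, Λ, φ, b)` with
`κK = uκ ∈ ℚ`; from `hker`/`hdual` a normalised `φ′` with `φ = 3^{λ₀}φ′` and `Λfin` with the (Λ)-clauses and the
interface; `a := b + (1 − v₃ uκ)⁺ + (−λ₀)⁺`; witnesses `t := 0`, `e := a + λ₀`, `κe := v₃ uκ + a ≥ 1`, `ι`, `κ := 3^a κK`,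
`Λ := 3^a Λ`, `Λfin`; RIDER₂ by `rider₂_of_compat`; the `ZetaBody` family by `zetaBody_smul (3^a)` on every admissible
datum.  Nothing about `exp*` is constructed. [cite: Kato2004Asterisque, (8.1.3) (p. 180), §9.4 (p. 188), Thm. 9.7 (p. 189), Ex. 13.3 (pp. 224–225)]
[cite: BlochKato1990, §3 (Prop. 3.8, Ex. 3.11)] [cite: Kim2022StructureSelmer, §3.3–§3.4.1 and Thm. 3.13] -/
theorem fineKatoUniform_of_definedKatoUniformRat :
    ∀ (W : WeierstrassCurve ℚ) [W.IsElliptic] [W.IsGloballyMinimal]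
    [ContinuousSMul ℤ_[3] (W.tateModule 3)] [Module.Free ℤ_[3] (W.tateModule 3)]
    [Module.Finite ℤ_[3] (W.tateModule 3)],
    (∀ m : ℕ, W.HasSurjectiveModNGaloisRep (3 ^ m : ℕ)) →
    ∀ (v₃ : HeightOneSpectrum (𝓞 ℚ)), ((3 : ℕ) : 𝓞 ℚ) ∈ v₃.asIdeal →
    ∀ {N : ℕ} [NeZero N] (P : ModularParametrizationData W N), N = W.conductorNorm ℤ →
      (∀ z ∈ P.L.lattice, ∃ w ∈ periodLattice P.f, z = P.c * w) →
      ∃ (t e κe : ℕ) (ι : (n : ℕ) → (CyclotomicField n ℚ →+* ℂ)) (κK : ℝ)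
        (Λ : ∀ (k' : ℕ) (r : Finset (HeightOneSpectrum (𝓞 ℚ))),
          H1 (tateRep W 3) (cycSubgroup 3 k' r) →ₗ[ℤ_[3]] ℚ_[3] ⊗[ℚ] CyclotomicField (cycLevel 3 k' r) ℚ)
        (Λfin : ∀ j : ℕ, galoisCohomology
          ((W.torsionGaloisModule (((3 : ℕ) : ℤ) ^ j * ((3 : ℕ) : ℤ))).toLocal (Sum.inr v₃)) 1 →+
            ZMod (3 ^ (j + 1))),
        κK ≠ 0 ∧ (∃ u : ℚ, (u : ℝ) = κK ∧ padicValRat 3 u = κe ∧ 1 ≤ κe) ∧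
        (∀ j : ℕ,
          (∀ c : ZMod (3 ^ (j + 1)), ∃ x ∈ propagatedSelmerStructure W 3 j (Sum.inr v₃), Λfin j x = c) ∧
          (∀ x ∈ propagatedSelmerStructure W 3 j (Sum.inr v₃),
            Λfin j x = 0 ↔ x ∈ W.kummerSelmerStructure (((3 : ℕ) : ℤ) ^ j * ((3 : ℕ) : ℤ)) (Sum.inr v₃))) ∧
        (∀ j : ℕ, RIDER₂⟦W, j, t, e, v₃, Λ, Λfin j⟧) ∧
        ∀ (c d a : ℤ) (A : ℕ), 0 < A → Int.gcd c (6 * 3 * A) = 1 → Int.gcd d (6 * 3 * N) = 1 →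
          ∃ (z : ∀ (k' : ℕ) (r : (cyclotomicLevelsRat 3 (badPlaces c d A N)).Ideals),
                H1 (tateRep W 3) ((cyclotomicLevelsRat 3 (badPlaces c d A N)).level k' r.1))
            (x : ∀ (k' : ℕ) (r : (cyclotomicLevelsRat 3 (badPlaces c d A N)).Ideals),
                CyclotomicField (cycLevel 3 k' r.1) ℚ),
            ZetaBody W 3 P.f ι κK Λ c d a A z x := by
  intro W _ _ _ _ _ htow v₃ hv₃ N _ P hN hlat
  haveI : Fact (Nat.Prime 3) := ⟨Nat.prime_three⟩
  obtain ⟨ι, κK, Λ, φ, hκ0, ⟨uκ, huκ⟩, hker, hdual, ⟨b, hcompat⟩, hz⟩ := hKUrat W htow v₃ hv₃ P hN hlat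
  have huκ0 : uκ ≠ 0 := by rintro rfl; exact hκ0 (by rw [← huκ, Rat.cast_zero])
  obtain ⟨φ', lam, Λfin, hint', hφ, hΛ, hI⟩ :=
    exists_finLevelFunctional_clauses_of_dual W 3 (Sum.inr v₃) φ hker hdual
  obtain ⟨aS, hab, hav, hal⟩ : ∃ aS : ℕ, b ≤ aS ∧ 1 ≤ padicValRat 3 uκ + aS ∧ 0 ≤ (aS : ℤ) + lam := by
    refine ⟨b + (1 - padicValRat 3 uκ).toNat + (-lam).toNat, by omega, ?_, ?_⟩
    · have := Int.self_le_toNat (1 - padicValRat 3 uκ); push_cast; omega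
    · have := Int.self_le_toNat (-lam); push_cast; omega
  set e : ℕ := ((aS : ℤ) + lam).toNat with hedef
  have he : (e : ℤ) = ((0 : ℕ) : ℤ) + aS + lam := by rw [hedef, Int.toNat_of_nonneg hal]; push_cast; ring
  set κe : ℕ := (padicValRat 3 uκ + aS).toNat with hκedef
  have hκe : ((κe : ℕ) : ℤ) = padicValRat 3 uκ + aS := by rw [hκedef, Int.toNat_of_nonneg (by omega)]
  have hκe1 : 1 ≤ κe := by omega
  have hΛeq : (fun k r => ((3 ^ aS : ℕ) : ℤ_[3]) • Λ k r) =
      (fun k' r => (((3 : ℕ) : ℤ_[3]) ^ aS) • Λ k' r) := by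
    funext k' r; rw [Nat.cast_pow]
  have hvu : padicValRat 3 ((3 : ℚ) ^ aS * uκ) = κe := by
    have h3 : padicValRat 3 (3 : ℚ) = 1 := by exact_mod_cast padicValRat.self (p := 3) (by norm_num)
    rw [padicValRat.mul (by positivity) huκ0, padicValRat.pow, h3, hκe]
    ring
  refine ⟨0, e, κe, ι, ((3 ^ aS : ℕ) : ℝ) * κK, fun k' r => (((3 : ℕ) : ℤ_[3]) ^ aS) • Λ k' r, Λfin,
    mul_ne_zero (by positivity) hκ0, ⟨(3 : ℚ) ^ aS * uκ, by rw [← huκ]; push_cast; ring, hvu, hκe1⟩, hΛ,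
    fun j => rider₂_of_compat W v₃ Λ φ φ' lam hφ hint' j (Λfin j) (hI j) b (hcompat j) aS 0 e hab he, ?_⟩
  intro c d a A hA hc hd
  obtain ⟨z, x, hbody⟩ := hz c d a A hA hc hd
  refine ⟨z, fun k r => ((3 ^ aS : ℕ) : ℚ) • x k r, ?_⟩
  have h := zetaBody_smul (3 ^ aS) hbody
  rwa [hΛeq] at h

/-- ★ **Crux `DeepUpperAtThree` (stmt-BirchSwinnertonDyer-19076) BY NAME from (C1ₑₓ⁺) and the route's four leaves, by
ONE-LINE composition with this seat's (C1ᵤ)-keyed glue** (`KimAtThreeDeepUpperUniformPinned.deepUpperAtThree_of_leaves_of_fineKatoUniform`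
on `fineKatoUniform_of_definedKatoUniformRat`) — the shape of the planner's (γ′) glue if (C1ₑₓ⁺) is the registered decl.
Conditional; nothing is booked. [cite: Kim2025RefinedTNC, Thm 1.1] [cite: Sakamoto2024, Thm. 4.4 (p. 926)] [cite: Carayol1986] -/
theorem deepUpperAtThree_of_leaves_of_definedKatoUniformRat (hSak : SakamotoKolyvaginThree)
    (hlev : CarayolLevelEqConductor) (hGZK : RankEqAnalyticRankLeOne) (hPT : PoitouTateSelmerDuality) :
    Summit.BirchSwinnertonDyer.BirchSwinnertonDyer.Theses.KimAtThreeKolyvagin.DeepUpperAtThree :=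
  KimAtThreeDeepUpperUniformPinned.deepUpperAtThree_of_leaves_of_fineKatoUniform
    (fineKatoUniform_of_definedKatoUniformRat hKUrat) hSak hGZK hPT hlev

/-- **The cell's DEEP statement and both parent cruxes from (C1ₑₓ⁺) and the route's four leaves, by ONE-LINE composition
with w2-c2 g7's ★★/★** (`KimAtThreeDeepLowerUniformOfFineKato.kimAtThreeDeepPUB_of_leaves_of_fineKatoUniform`,
`deepLower_and_deepUpper_of_leaves_of_fineKatoUniform` on `fineKatoUniform_of_definedKatoUniformRat`).  Conditional.
[cite: Kim2025RefinedTNC, Thm 1.1] [cite: Sakamoto2024, Thm. 4.4 (p. 926)] [cite: Carayol1986] -/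
theorem kimAtThreeDeepPUB_of_leaves_of_definedKatoUniformRat (hlev : CarayolLevelEqConductor)
    (hSak : SakamotoKolyvaginThree) (hGZK : RankEqAnalyticRankLeOne) (hPT : PoitouTateSelmerDuality) :
    N11.KimAtThreeDeepPUB ∧ (DeepLowerAtThree ∧ DeepUpperAtThree) :=
  ⟨kimAtThreeDeepPUB_of_leaves_of_fineKatoUniform (fineKatoUniform_of_definedKatoUniformRat hKUrat) hlev hSak hGZK hPT,
    deepLower_and_deepUpper_of_leaves_of_fineKatoUniform (fineKatoUniform_of_definedKatoUniformRat hKUrat) hlev hSak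
      hGZK hPT⟩

end Rat

end Summit.BirchSwinnertonDyer.BirchSwinnertonDyer.Theorems.KimAtThreeDeepUpperFineKatoUniformOfDefinedKato

end
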